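import Literature.NumberTheory.Rogawski1990.ArchTorusOrbitalOneSidedLimitsRelabel   -- ★ LH3-p04 (g2): per-place, per-partner (C-bdry) in three-limit form
import Literature.NumberTheory.Rogawski1990.ArchGlobalStableOrbitalWallDeriv        -- ★ (δ) F0P3a-p07: `integral_comp_conj_archDiagTorus_update_comp_eq_integral_partial` (global = per-place along the updated curve); brings ★ (V7)-smooth
import HarnessLib

/-!
# (C-bdry) GLOBAL: one-sided limits of `2 sin ψ · ∫_{G′_∞} Θ(↑↑(g·t((z^ψ)∘ρ)·g⁻¹)) dν_∞` and the two-sided limit of its `ψ`-derivative at a noncompact wall of ONE indefinite place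
# (Varadarajan 1989 §6.4 Thms 18, 20, 22; Rogawski 1990 §8.2 pp. 119, 122–124, §8.3 p. 122; Borel–Jacquet §4.1)

Topic `NumberTheory/Rogawski1990`; namespace `Literature.NumberTheory.Rogawski1990`.  THEOREMS ONLY (no `def`, no instance, no notation, no axiom, no named fact, no `sorry`).
Cell `pub/hodgecm-mathlib`, line LH3 (closer stub `stub_N9`, crux H413 = `stmt-HodgeConjecture-24833`), input **(C-bdry-glob)** of organ (M2-01) «the Δ″-side of `a′ ∈ C_c^∞(G′_∞)` is
continuous with its first normal derivative across a `G`-wall at an indefinite place» (LH3-plan (g2) 05:33∕05:36Z; LH3-p04 (g2) census (4), 2026-09-02): the order-0∕1 single-partner twin of ★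
(δ) `ArchGlobalStableOrbitalWallDeriv` — same setting, same bookkeeping, with ★ (C-bdry-ρ) `exists_tendsto_two_sin_mul_integral_comp_conj_splitCurve_comp_perm` in place of J1.

SETTING (★ (δ) verbatim).  `G′_∞ = U(diag α)(L⁺ ⊗ ℝ) ≃ₜ* Π_v G_v` (★ `archPiEquivCM`), per-place Haar measures `ν_v` and the product convention `ν_∞ = e⁻¹_*(⊗ ν_v)`; a place `w`; a global
torus point `z` REGULAR AT EVERY `v ≠ w` with `z_w` split-singular (`z w 0 = z w 2 ≠ z w 1`); the global one-angle curve `z^ψ = update z w (i ↦ z w i · e^{i(1,0,−1)_i ψ})`; a relabelling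
`ρ : W → S₃` whose `w`-wall is NONCOMPACT (`re σ_w(α_{ρ_w⁻¹0})·re σ_w(α_{ρ_w⁻¹2}) < 0`); an ambient-smooth `Θ : M₃(L ⊗ ℝ) → ℂ` compactly supported on the group.

THE MATHEMATICS.  For small `ψ ≠ 0` the relabelled point `(z^ψ)∘ρ` is regular at every place (★ `eventually_injective_splitCurve` at `w`, hypothesis off `w`), so ★ (δ) §2 reads the
global torus orbital integral as the `w`-torus orbital integral of the PARTIAL ORBITAL lambda over the other places, which ★ (V7)-smooth `exists_contDiff_partialOrbital_eq` identifies with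
`x ↦ Θ′(↑↑x)` for an ambient-smooth `Θ′` compactly supported on `G_w`; on that punctured neighbourhood the global function IS the per-place function of ★ (C-bdry-ρ), whose three
limits transfer (the neighbourhood is open, so the derivatives agree there too).

WHAT IS PROVED.  **`exists_tendsto_two_sin_mul_integral_comp_conj_archDiagTorus_update_splitCurve_comp`** — `∃ Jp Jm D`, one-sided limits of
`G(ψ) = 2 sin ψ · ∫_{G′_∞} Θ(↑↑(g·t((z^ψ)∘ρ)·g⁻¹)) dν_∞` at `0±` and ONE two-sided punctured limit of `G′`.
HONEST LABEL: HC_CM is proved only modulo the 7 printed citations (2 remaining: hLiu418 = stmt-HodgeConjecture-24832, h413 = stmt-HodgeConjecture-24833) until rung 0 closes; kit for (M2-01),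
pays nothing by itself.

## References
* [Varadarajan1989] V. S. Varadarajan, *An Introduction to Harmonic Analysis on Semisimple Lie Groups* (1989), §6.4 Thm 18, Thm 20, Thm 22.
* [Rogawski1990] J. D. Rogawski, *Automorphic Representations of Unitary Groups in Three Variables*, Ann. of Math. Stud. 123 (1990), §8.2 pp. 119, 122–124, §8.3 p. 122.
* [BorelJacquet1979] A. Borel, H. Jacquet, *Automorphic forms and automorphic representations*, PSPM 33.1 (1979), §4.1.
-/

set_option autoImplicit false

noncomputable section

open MeasureTheory Measure Filter Topology NumberField NumberField.InfinitePlace NumberField.mixedEmbedding Equiv Function Set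
open Literature.MeasureTheory.Group Literature.NumberTheory.Automorphic Literature.NumberTheory.Automorphic.UnitaryGroup
open Literature.LinearAlgebra.Matrix
open scoped Matrix MatrixGroups Matrix.Norms.Operator ContDiff

namespace Literature.NumberTheory.Rogawski1990

section Global

variable (L : Type) [Field L] [NumberField L] [IsCMField L] (α : Fin 3 → L) (w : {w : InfinitePlace L // IsComplex w})
  [MeasurableSpace (GL (Fin 3) ℂ)] [BorelSpace (GL (Fin 3) ℂ)]
  [MeasurableSpace (arch (↥(maximalRealSubfield L)) L (IsCMField.complexConj L) 3 (Matrix.diagonal α))] [BorelSpace (arch (↥(maximalRealSubfield L)) L (IsCMField.complexConj L) 3 (Matrix.diagonal α))]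

open scoped Classical in
/-- **(C-bdry) GLOBAL — THREE-LIMIT FORM AT A NONCOMPACT WALL OF ONE INDEFINITE PLACE**: in the setting above there are `Jp Jm D : ℂ` with
`G → Jp` (`ψ → 0⁺`), `G → Jm` (`ψ → 0⁻`), `G′ → D` (`ψ → 0`, `ψ ≠ 0`) for `G(ψ) = 2 sin ψ · ∫_{G′_∞} Θ(↑↑(g·t((z^ψ)∘ρ)·g⁻¹)) dν_∞`.  Proof: module docstring (★ (δ) §2 + ★ (V7)-smooth +
★ (C-bdry-ρ) at `w`, transferred along the eventual equality on the open punctured neighbourhood where `(z^ψ)∘ρ` is regular). [cite: Varadarajan1989, §6.4 Thm 18, Thm 20, Thm 22]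
[cite: Rogawski1990, §8.2 p. 119; §8.3 p. 122] [cite: BorelJacquet1979, §4.1] -/
theorem exists_tendsto_two_sin_mul_integral_comp_conj_archDiagTorus_update_splitCurve_comp
    (νw : ∀ v : {w : InfinitePlace L // IsComplex w}, Measure (archLocal L 3 (Matrix.diagonal α) v)) [∀ v, (νw v).IsHaarMeasure]
    (hα : ∀ i, α i ≠ 0) (hherm : ∀ i, (IsCMField.complexConj L (α i) : L) = α i)
    (Θ : Matrix (Fin 3) (Fin 3) (mixedSpace L) → ℂ) (hΘ : ContDiff ℝ (⊤ : ℕ∞) Θ)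
    (hΘc : HasCompactSupport fun g : arch (↥(maximalRealSubfield L)) L (IsCMField.complexConj L) 3 (Matrix.diagonal α) => Θ ((g : GL (Fin 3) (mixedSpace L)) : Matrix (Fin 3) (Fin 3) (mixedSpace L)))
    (z : {w : InfinitePlace L // IsComplex w} → Fin 3 → Circle) (hz : ∀ v, v ≠ w → Function.Injective (z v)) (h02 : z w 0 = z w 2) (h01 : z w 0 ≠ z w 1)
    (ρ : {w : InfinitePlace L // IsComplex w} → Perm (Fin 3))
    (hnc : (w.1.embedding (α ((ρ w)⁻¹ 0))).re * (w.1.embedding (α ((ρ w)⁻¹ 2))).re < 0) :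
    ∃ Jp Jm D : ℂ,
      Tendsto (fun ψ : ℝ => (2 * Real.sin ψ : ℂ) *
          ∫ g, Θ (((g * archDiagTorus L 3 α (fun v => Function.update z w (fun i => z w i * Circle.exp (![(1 : ℝ), 0, -1] i * ψ)) v ∘ ⇑(ρ v)) * g⁻¹ :
            arch (↥(maximalRealSubfield L)) L (IsCMField.complexConj L) 3 (Matrix.diagonal α)) : GL (Fin 3) (mixedSpace L)) : Matrix (Fin 3) (Fin 3) (mixedSpace L))
            ∂((Measure.pi νw).map (archPiEquivCM 3 L (Matrix.diagonal α)).symm)) (𝓝[>] 0) (𝓝 Jp) ∧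
      Tendsto (fun ψ : ℝ => (2 * Real.sin ψ : ℂ) *
          ∫ g, Θ (((g * archDiagTorus L 3 α (fun v => Function.update z w (fun i => z w i * Circle.exp (![(1 : ℝ), 0, -1] i * ψ)) v ∘ ⇑(ρ v)) * g⁻¹ :
            arch (↥(maximalRealSubfield L)) L (IsCMField.complexConj L) 3 (Matrix.diagonal α)) : GL (Fin 3) (mixedSpace L)) : Matrix (Fin 3) (Fin 3) (mixedSpace L))
            ∂((Measure.pi νw).map (archPiEquivCM 3 L (Matrix.diagonal α)).symm)) (𝓝[<] 0) (𝓝 Jm) ∧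
      Tendsto (fun ψ : ℝ => deriv (fun ψ : ℝ => (2 * Real.sin ψ : ℂ) *
          ∫ g, Θ (((g * archDiagTorus L 3 α (fun v => Function.update z w (fun i => z w i * Circle.exp (![(1 : ℝ), 0, -1] i * ψ)) v ∘ ⇑(ρ v)) * g⁻¹ :
            arch (↥(maximalRealSubfield L)) L (IsCMField.complexConj L) 3 (Matrix.diagonal α)) : GL (Fin 3) (mixedSpace L)) : Matrix (Fin 3) (Fin 3) (mixedSpace L))
            ∂((Measure.pi νw).map (archPiEquivCM 3 L (Matrix.diagonal α)).symm)) ψ) (𝓝[≠] 0) (𝓝 D) := by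
  have hreal : ∀ i, (w.1.embedding (α i)).im = 0 := fun i => im_embedding_eq_zero_of_complexConj_eq L w (hherm i)
  haveI : ∀ v : {w : InfinitePlace L // IsComplex w}, LocallyCompactSpace (archLocal L 3 (Matrix.diagonal α) v) := fun v => locallyCompactSpace_archLocal L 3 (Matrix.diagonal α) v
  haveI : ∀ v : {w : InfinitePlace L // IsComplex w}, SecondCountableTopology (archLocal L 3 (Matrix.diagonal α) v) := fun v => secondCountableTopology_archLocal L 3 (Matrix.diagonal α) v
  -- the partial orbital lambda over the places `v ≠ w` at the relabelled base `(z_v ∘ ρ_v)_v` is an ambient-smooth test function `Θ′` on `G_w`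
  obtain ⟨Θ', hΘ', hΘ'c, hΘ'eq⟩ := exists_contDiff_partialOrbital_eq L 3 α νw hα w Θ hΘ hΘc (z := fun v => z v ∘ ⇑(ρ v))
    (fun v hv => (hz v hv).comp (ρ v).injective)
  -- the per-place function at `w` and its three limits (★ (C-bdry-ρ))
  obtain ⟨Jp, Jm, D, hJp, hJm, hD⟩ := exists_tendsto_two_sin_mul_integral_comp_conj_splitCurve_comp_perm L α w hα hreal (νw w) Θ' hΘ' hΘ'c (z w) h02 h01 (ρ w) hnc
  -- the open set of regular parameters at `w`, a punctured neighbourhood of `0`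
  set T : Set ℝ := {ψ | Function.Injective fun i => z w i * Circle.exp (![(1 : ℝ), 0, -1] i * ψ)} with hT
  have hTopen : IsOpen T := isOpen_setOf_injective.preimage (continuous_torusCurve (z w) ![(1 : ℝ), 0, -1])
  have hTev : ∀ᶠ ψ in 𝓝[≠] (0 : ℝ), ψ ∈ T := eventually_injective_splitCurve (z w) h02 h01
  -- on `T` the global function IS the per-place one
  have heq : ∀ ψ ∈ T, (2 * Real.sin ψ : ℂ) *
      ∫ g, Θ (((g * archDiagTorus L 3 α (fun v => Function.update z w (fun i => z w i * Circle.exp (![(1 : ℝ), 0, -1] i * ψ)) v ∘ ⇑(ρ v)) * g⁻¹ :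
        arch (↥(maximalRealSubfield L)) L (IsCMField.complexConj L) 3 (Matrix.diagonal α)) : GL (Fin 3) (mixedSpace L)) : Matrix (Fin 3) (Fin 3) (mixedSpace L))
        ∂((Measure.pi νw).map (archPiEquivCM 3 L (Matrix.diagonal α)).symm) =
      (2 * Real.sin ψ : ℂ) * ∫ g : archLocal L 3 (Matrix.diagonal α) w,
        Θ' ((((g * ⟨circleDiagonal 3 ((fun i => z w i * Circle.exp (![(1 : ℝ), 0, -1] i * ψ)) ∘ ⇑(ρ w)), circleDiagonal_mem_archLocal_diagonal L 3 α w _⟩ * g⁻¹ :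
          archLocal L 3 (Matrix.diagonal α) w) : GL (Fin 3) ℂ) : Matrix (Fin 3) (Fin 3) ℂ)) ∂(νw w) := by
    intro ψ hψ
    have hreg : ∀ v, Function.Injective (Function.update z w (fun i => z w i * Circle.exp (![(1 : ℝ), 0, -1] i * ψ)) v ∘ ⇑(ρ v)) := by
      intro v
      by_cases hv : v = w
      · subst hv; rw [Function.update_self]; exact (show Function.Injective _ from hψ).comp (ρ v).injective
      · rw [Function.update_of_ne hv]; exact (hz v hv).comp (ρ v).injective
    rw [integral_comp_conj_archDiagTorus_update_comp_eq_integral_partial L α w νw hα Θ hΘ.continuous hΘc z _ ρ hreg]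
    congr 1
    refine integral_congr_ae (Eventually.of_forall fun x => ?_)
    exact (hΘ'eq _).symm
  have hEv : ∀ᶠ ψ in 𝓝[≠] (0 : ℝ), (2 * Real.sin ψ : ℂ) *
      ∫ g, Θ (((g * archDiagTorus L 3 α (fun v => Function.update z w (fun i => z w i * Circle.exp (![(1 : ℝ), 0, -1] i * ψ)) v ∘ ⇑(ρ v)) * g⁻¹ :
        arch (↥(maximalRealSubfield L)) L (IsCMField.complexConj L) 3 (Matrix.diagonal α)) : GL (Fin 3) (mixedSpace L)) : Matrix (Fin 3) (Fin 3) (mixedSpace L))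
        ∂((Measure.pi νw).map (archPiEquivCM 3 L (Matrix.diagonal α)).symm) =
      (2 * Real.sin ψ : ℂ) * ∫ g : archLocal L 3 (Matrix.diagonal α) w,
        Θ' ((((g * ⟨circleDiagonal 3 ((fun i => z w i * Circle.exp (![(1 : ℝ), 0, -1] i * ψ)) ∘ ⇑(ρ w)), circleDiagonal_mem_archLocal_diagonal L 3 α w _⟩ * g⁻¹ :
          archLocal L 3 (Matrix.diagonal α) w) : GL (Fin 3) ℂ) : Matrix (Fin 3) (Fin 3) ℂ)) ∂(νw w) := hTev.mono heq
  -- the derivatives agree on the open set `T`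
  have hDev : ∀ᶠ ψ in 𝓝[≠] (0 : ℝ), deriv (fun ψ : ℝ => (2 * Real.sin ψ : ℂ) *
      ∫ g, Θ (((g * archDiagTorus L 3 α (fun v => Function.update z w (fun i => z w i * Circle.exp (![(1 : ℝ), 0, -1] i * ψ)) v ∘ ⇑(ρ v)) * g⁻¹ :
        arch (↥(maximalRealSubfield L)) L (IsCMField.complexConj L) 3 (Matrix.diagonal α)) : GL (Fin 3) (mixedSpace L)) : Matrix (Fin 3) (Fin 3) (mixedSpace L))
        ∂((Measure.pi νw).map (archPiEquivCM 3 L (Matrix.diagonal α)).symm)) ψ =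
      deriv (fun ψ : ℝ => (2 * Real.sin ψ : ℂ) * ∫ g : archLocal L 3 (Matrix.diagonal α) w,
        Θ' ((((g * ⟨circleDiagonal 3 ((fun i => z w i * Circle.exp (![(1 : ℝ), 0, -1] i * ψ)) ∘ ⇑(ρ w)), circleDiagonal_mem_archLocal_diagonal L 3 α w _⟩ * g⁻¹ :
          archLocal L 3 (Matrix.diagonal α) w) : GL (Fin 3) ℂ) : Matrix (Fin 3) (Fin 3) ℂ)) ∂(νw w)) ψ := by
    refine hTev.mono fun ψ hψ => Filter.EventuallyEq.deriv_eq ?_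
    exact Filter.eventually_of_mem (hTopen.mem_nhds hψ) fun ψ' hψ' => heq ψ' hψ'
  have hGT : (𝓝[>] (0 : ℝ)) ≤ 𝓝[≠] 0 := nhdsWithin_mono _ fun x hx => ne_of_gt hx
  have hLT : (𝓝[<] (0 : ℝ)) ≤ 𝓝[≠] 0 := nhdsWithin_mono _ fun x hx => ne_of_lt hx
  exact ⟨Jp, Jm, D, hJp.congr' ((hEv.filter_mono hGT).mono fun _ h => h.symm), hJm.congr' ((hEv.filter_mono hLT).mono fun _ h => h.symm),
    hD.congr' (hDev.mono fun _ h => h.symm)⟩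

end Global

end Literature.NumberTheory.Rogawski1990

end
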